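import Summits.KontsevichZagierPeriods.KontsevichZagierPeriods.Theses.IsogenyCertificates
import Literature.NumberTheory.Transcendental.KZCalculus
import Literature.ModelTheory.ExponentialFields.SemialgebraicComponents

/-!
# `XMapPeriodTransfer` (stmt-KontsevichZagierPeriods-10665), line `saturated-sign-cells` — basic API

Support file (no definitions) for the line `saturated-sign-cells` of the crux
`IsogenyCertificates.XMapPeriodTransfer` (Cruxes/XMapPeriodTransfer/PICKED.md). The line works with
the following objects, always written out explicitly (no `def`s are introduced anywhere in the line):

* the real x-map `R = fun y => aeval y f / aeval y g` and the real Wronskian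
  `W = fun y => aeval y (derivative f * g - f * derivative g)` of a datum `(f, g, c)`;
* the CELL LOCUS `L = {y | 0 < y³ + Ay + B ∧ W y ≠ 0} ⊆ ℝ`, whose connected components are the cells;
* the UNBOUNDED COMPONENT `U = connectedComponentIn {y | 0 < y³ + Ay + B} (1 + |A| + |B|)` of `{P > 0}`
  and the EGG `{P > 0} ∖ U`.

This file proves the immediate facts every stub of the line needs: `P > 0` at and beyond
`1 + |A| + |B|`, openness, and `ℚ`-semialgebraicity of the traces `{x : Fin 1 → ℝ | x 0 ∈ ·}` in
`ℝ¹` (the form in which these sets enter `KZ.IntegralRep 1`), the key input being that connected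
components of `ℚ`-semialgebraic sets are `ℚ`-semialgebraic [Basu–Pollack–Roy 2006, Thm. 5.22]
(tree: `IsSemialgebraic.isSemialgebraic_connectedComponentIn`), transported along `ℝ¹ ≃ₜ ℝ`.

References: M. Kontsevich, D. Zagier, *Periods* (2001), §1.2; S. Basu, R. Pollack, M.-F. Roy,
*Algorithms in Real Algebraic Geometry* (2006), Thm. 5.22.
-/

noncomputable section

open Set Polynomial MeasureTheory
open Literature.ModelTheory.ExponentialFields (IsSemialgebraic isSemialgebraic_setOf_eval_pos
  isSemialgebraic_setOf_eval_ne_zero)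

namespace Summit.KontsevichZagierPeriods.IsogenyCertificates.XMapPeriodTransferCells

/-- `P(z) > 0` for every `z ≥ 1 + |A| + |B|`. [folklore] -/
theorem cubic_pos_of_large_le (A B : ℤ) {z : ℝ} (hz : 1 + |(A : ℝ)| + |(B : ℝ)| ≤ z) :
    0 < z ^ 3 + (A : ℝ) * z + (B : ℝ) := by
  have hA : -|(A : ℝ)| ≤ (A : ℝ) := neg_abs_le _
  have hB : -|(B : ℝ)| ≤ (B : ℝ) := neg_abs_le _
  have h0A : 0 ≤ |(A : ℝ)| := abs_nonneg _
  have h0B : 0 ≤ |(B : ℝ)| := abs_nonneg _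
  have hz1 : 1 ≤ z := by linarith
  have hz0 : 0 ≤ z := by linarith
  nlinarith [mul_le_mul_of_nonneg_left hA hz0, sq_nonneg z, mul_le_mul_of_nonneg_left hz1 hz0,
    mul_le_mul_of_nonneg_left hz hz0, mul_nonneg hz0 h0B]

/-- `{P > 0}` is open. [folklore] -/
theorem isOpen_setOf_cubic_pos (A B : ℤ) : IsOpen {y : ℝ | 0 < y ^ 3 + (A : ℝ) * y + (B : ℝ)} :=
  isOpen_lt continuous_const (by fun_prop)

/-- The cell locus `{P > 0, W ≠ 0}` is open. [folklore] -/
theorem isOpen_cellLocus (A B : ℤ) (f g : ℚ[X]) :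
    IsOpen {y : ℝ | 0 < y ^ 3 + (A : ℝ) * y + (B : ℝ) ∧
      aeval y (derivative f * g - f * derivative g) ≠ 0} :=
  (isOpen_setOf_cubic_pos A B).inter
    (isOpen_ne_fun (Polynomial.continuous_aeval _) continuous_const)

/-- The point `1 + |A| + |B|` lies in the unbounded component of `{P > 0}`. [folklore] -/
theorem large_mem_unbounded (A B : ℤ) :
    1 + |(A : ℝ)| + |(B : ℝ)| ∈
      connectedComponentIn {y : ℝ | 0 < y ^ 3 + (A : ℝ) * y + (B : ℝ)} (1 + |(A : ℝ)| + |(B : ℝ)|) :=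
  mem_connectedComponentIn (cubic_pos_of_large_le A B le_rfl)

/-- `[1 + |A| + |B|, ∞)` lies in the unbounded component of `{P > 0}`. [folklore] -/
theorem Ici_large_subset_unbounded (A B : ℤ) :
    Ici (1 + |(A : ℝ)| + |(B : ℝ)|) ⊆
      connectedComponentIn {y : ℝ | 0 < y ^ 3 + (A : ℝ) * y + (B : ℝ)} (1 + |(A : ℝ)| + |(B : ℝ)|) :=
  (isPreconnected_Ici).subset_connectedComponentIn self_mem_Ici
    (fun _ hz => cubic_pos_of_large_le A B hz)

/-- The unbounded component of `{P > 0}` is open. [folklore] -/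
theorem isOpen_unbounded (A B : ℤ) :
    IsOpen (connectedComponentIn {y : ℝ | 0 < y ^ 3 + (A : ℝ) * y + (B : ℝ)} (1 + |(A : ℝ)| + |(B : ℝ)|)) :=
  (isOpen_setOf_cubic_pos A B).connectedComponentIn

/-! ### The corresponding subsets of `ℝ¹ = Fin 1 → ℝ` are `ℚ`-semialgebraic -/

/-- Evaluation of a one-variable polynomial read in the coordinate `X 0` of `ℝ¹`. [folklore] -/
theorem aeval_aeval_X_zero (p : ℚ[X]) (x : Fin 1 → ℝ) :
    MvPolynomial.aeval x (aeval (MvPolynomial.X 0 : MvPolynomial (Fin 1) ℚ) p) = aeval (x 0) p := by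
  rw [← aeval_algHom_apply, MvPolynomial.aeval_X]

/-- `{x ∈ ℝ¹ | P(x 0) > 0}` is `ℚ`-semialgebraic. [cite: BochnakCosteRoy1998, Def. 2.1.4] -/
theorem isSemialgebraic_hat_cubic_pos (A B : ℤ) :
    IsSemialgebraic ℚ {x : Fin 1 → ℝ | x 0 ∈ {y : ℝ | 0 < y ^ 3 + (A : ℝ) * y + (B : ℝ)}} := by
  convert isSemialgebraic_setOf_eval_pos (k := ℚ) (R := ℝ)
    (MvPolynomial.X 0 ^ 3 + MvPolynomial.C (A : ℚ) * MvPolynomial.X 0 + MvPolynomial.C (B : ℚ) :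
      MvPolynomial (Fin 1) ℚ) using 1
  ext x; simp

/-- `{x ∈ ℝ¹ | x 0 ∈ cell locus}` is `ℚ`-semialgebraic (basic: `P > 0`, `W ≠ 0`).
[cite: BochnakCosteRoy1998, Def. 2.1.4] -/
theorem isSemialgebraic_hat_cellLocus (A B : ℤ) (f g : ℚ[X]) :
    IsSemialgebraic ℚ {x : Fin 1 → ℝ | x 0 ∈ {y : ℝ | 0 < y ^ 3 + (A : ℝ) * y + (B : ℝ) ∧
      aeval y (derivative f * g - f * derivative g) ≠ 0}} := by
  have h := (isSemialgebraic_setOf_eval_pos (k := ℚ) (R := ℝ)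
    (MvPolynomial.X 0 ^ 3 + MvPolynomial.C (A : ℚ) * MvPolynomial.X 0 + MvPolynomial.C (B : ℚ) :
      MvPolynomial (Fin 1) ℚ)).inter
    (isSemialgebraic_setOf_eval_ne_zero (k := ℚ) (R := ℝ)
      (aeval (MvPolynomial.X 0 : MvPolynomial (Fin 1) ℚ) (derivative f * g - f * derivative g)))
  convert h using 1
  ext x
  simp only [mem_setOf_eq, mem_inter_iff, aeval_aeval_X_zero]
  simp

/-- Transport of connected components along `ℝ¹ ≃ₜ ℝ`, `x ↦ x 0`. [folklore] -/
theorem hat_connectedComponentIn (S : Set ℝ) (y : ℝ) :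
    {x : Fin 1 → ℝ | x 0 ∈ connectedComponentIn S y} =
      connectedComponentIn {x : Fin 1 → ℝ | x 0 ∈ S} (fun _ => y) := by
  set e : (Fin 1 → ℝ) ≃ₜ ℝ := Homeomorph.funUnique (Fin 1) ℝ with he
  have hS : {x : Fin 1 → ℝ | x 0 ∈ S} = e.symm '' S := by
    rw [← Homeomorph.preimage_symm, Homeomorph.symm_symm]; rfl
  by_cases hy : y ∈ S
  · have h := e.symm.image_connectedComponentIn (s := S) hy
    rw [← hS] at h
    have hy' : e.symm y = fun _ => y := by
      ext i; simp [he, Homeomorph.funUnique]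
    rw [hy'] at h
    rw [← h, ← Homeomorph.preimage_symm, Homeomorph.symm_symm]; rfl
  · rw [connectedComponentIn_eq_empty hy, connectedComponentIn_eq_empty (by simpa using hy)]
    simp

/-- Connected components of (the `ℝ`-trace of) a `ℚ`-semialgebraic subset of `ℝ¹` give
`ℚ`-semialgebraic subsets of `ℝ¹`. [cite: BasuPollackRoy2006, Thm. 5.22] -/
theorem isSemialgebraic_hat_connectedComponentIn {S : Set ℝ}
    (hS : IsSemialgebraic ℚ {x : Fin 1 → ℝ | x 0 ∈ S}) (y : ℝ) :
    IsSemialgebraic ℚ {x : Fin 1 → ℝ | x 0 ∈ connectedComponentIn S y} := by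
  rw [hat_connectedComponentIn]
  exact hS.isSemialgebraic_connectedComponentIn _

/-- The `ℝ`-trace of a `ℚ`-semialgebraic subset of `ℝ¹` has finitely many connected components.
[cite: BasuPollackRoy2006, Thm. 5.22] -/
theorem finite_setOf_connectedComponentIn {S : Set ℝ}
    (hS : IsSemialgebraic ℚ {x : Fin 1 → ℝ | x 0 ∈ S}) :
    {K : Set ℝ | ∃ y ∈ S, K = connectedComponentIn S y}.Finite := by
  have hfin := hS.finite_setOf_connectedComponentIn
  have hmap : {K : Set ℝ | ∃ y ∈ S, K = connectedComponentIn S y} ⊆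
      (fun K' : Set (Fin 1 → ℝ) => (fun t : ℝ => (fun _ : Fin 1 => t)) ⁻¹' K') ''
        {K' | ∃ x ∈ {x : Fin 1 → ℝ | x 0 ∈ S}, K' = connectedComponentIn {x : Fin 1 → ℝ | x 0 ∈ S} x} := by
    rintro K ⟨y, hy, rfl⟩
    refine ⟨connectedComponentIn {x : Fin 1 → ℝ | x 0 ∈ S} (fun _ => y), ⟨fun _ => y, hy, rfl⟩, ?_⟩
    rw [← hat_connectedComponentIn]
    ext t
    simp
  exact (hfin.image _).subset hmap

/-- Every cell `{x ∈ ℝ¹ | x 0 ∈ connectedComponentIn (cell locus) y}` is `ℚ`-semialgebraic.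
[cite: BasuPollackRoy2006, Thm. 5.22] -/
theorem isSemialgebraic_hat_cell (A B : ℤ) (f g : ℚ[X]) (y : ℝ) :
    IsSemialgebraic ℚ {x : Fin 1 → ℝ | x 0 ∈ connectedComponentIn
      {y : ℝ | 0 < y ^ 3 + (A : ℝ) * y + (B : ℝ) ∧ aeval y (derivative f * g - f * derivative g) ≠ 0} y} :=
  isSemialgebraic_hat_connectedComponentIn (isSemialgebraic_hat_cellLocus A B f g) y

/-- `{x ∈ ℝ¹ | x 0 ∈ unbounded component}` is `ℚ`-semialgebraic. [cite: BasuPollackRoy2006, Thm. 5.22] -/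
theorem isSemialgebraic_hat_unbounded (A B : ℤ) :
    IsSemialgebraic ℚ {x : Fin 1 → ℝ | x 0 ∈
      connectedComponentIn {y : ℝ | 0 < y ^ 3 + (A : ℝ) * y + (B : ℝ)} (1 + |(A : ℝ)| + |(B : ℝ)|)} :=
  isSemialgebraic_hat_connectedComponentIn (isSemialgebraic_hat_cubic_pos A B) _

/-- `{x ∈ ℝ¹ | x 0 ∈ egg}` is `ℚ`-semialgebraic. [cite: BasuPollackRoy2006, Thm. 5.22] -/
theorem isSemialgebraic_hat_egg (A B : ℤ) :
    IsSemialgebraic ℚ {x : Fin 1 → ℝ | x 0 ∈ {y : ℝ | 0 < y ^ 3 + (A : ℝ) * y + (B : ℝ)} \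
      connectedComponentIn {y : ℝ | 0 < y ^ 3 + (A : ℝ) * y + (B : ℝ)} (1 + |(A : ℝ)| + |(B : ℝ)|)} :=
  (isSemialgebraic_hat_cubic_pos A B).diff (isSemialgebraic_hat_unbounded A B)

/-- Finite sets of values of the coordinate are Lebesgue-null in `ℝ¹`. [folklore] -/
theorem volume_hat_eq_zero_of_finite {F : Set ℝ} (hF : F.Finite) :
    MeasureTheory.volume {x : Fin 1 → ℝ | x 0 ∈ F} = 0 := by
  have h : {x : Fin 1 → ℝ | x 0 ∈ F} = (fun t : ℝ => (fun _ : Fin 1 => t)) '' F := by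
    ext x
    simp only [mem_setOf_eq, mem_image]
    constructor
    · intro hx; exact ⟨x 0, hx, by funext i; rw [Fin.fin_one_eq_zero i]⟩
    · rintro ⟨t, ht, rfl⟩; exact ht
  rw [h]
  exact (hF.image _).measure_zero _

/-- **Registered stub `stub_cellsBasic`** of the line's skeleton (Cruxes/XMapPeriodTransfer/Lines/
saturated-sign-cells.lean): the basic API above, bundled. [folklore] -/
theorem stub_cellsBasic :
    (∀ (A B : ℤ) (z : ℝ), 1 + |(A : ℝ)| + |(B : ℝ)| ≤ z → 0 < z ^ 3 + (A : ℝ) * z + (B : ℝ)) ∧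
    (∀ (A B : ℤ), IsSemialgebraic ℚ {x : Fin 1 → ℝ | x 0 ∈ {y : ℝ | 0 < y ^ 3 + (A : ℝ) * y + (B : ℝ)}}) ∧
    (∀ (A B : ℤ) (f g : ℚ[X]) (y : ℝ), IsSemialgebraic ℚ {x : Fin 1 → ℝ | x 0 ∈ connectedComponentIn
      {y : ℝ | 0 < y ^ 3 + (A : ℝ) * y + (B : ℝ) ∧ aeval y (derivative f * g - f * derivative g) ≠ 0} y}) ∧
    (∀ (A B : ℤ), IsSemialgebraic ℚ {x : Fin 1 → ℝ | x 0 ∈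
      connectedComponentIn {y : ℝ | 0 < y ^ 3 + (A : ℝ) * y + (B : ℝ)} (1 + |(A : ℝ)| + |(B : ℝ)|)}) ∧
    (∀ (A B : ℤ), IsSemialgebraic ℚ {x : Fin 1 → ℝ | x 0 ∈ {y : ℝ | 0 < y ^ 3 + (A : ℝ) * y + (B : ℝ)} \
      connectedComponentIn {y : ℝ | 0 < y ^ 3 + (A : ℝ) * y + (B : ℝ)} (1 + |(A : ℝ)| + |(B : ℝ)|)}) ∧
    (∀ (S : Set ℝ), IsSemialgebraic ℚ {x : Fin 1 → ℝ | x 0 ∈ S} →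
      {K : Set ℝ | ∃ y ∈ S, K = connectedComponentIn S y}.Finite) ∧
    (∀ (F : Set ℝ), F.Finite → volume {x : Fin 1 → ℝ | x 0 ∈ F} = 0) :=
  ⟨fun A B _ hz => cubic_pos_of_large_le A B hz, isSemialgebraic_hat_cubic_pos,
    isSemialgebraic_hat_cell, isSemialgebraic_hat_unbounded, isSemialgebraic_hat_egg,
    fun _ hS => finite_setOf_connectedComponentIn hS, fun _ hF => volume_hat_eq_zero_of_finite hF⟩

end Summit.KontsevichZagierPeriods.IsogenyCertificates.XMapPeriodTransferCells

end
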